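import Mathlib.Data.Nat.Bitwise
import Mathlib.Data.List.Chain
import Mathlib.Data.List.Nodup
import HarnessLib

/-!
# Small thickness `(111)`-films, I: the KERNEL CHECKER — a bitboard model of a radius-`4` block of `F_k` (`k ≤ 9`) and swap-pair plans

builds on p205010 (kernel theorem, internal audit signed; external expert review pending) — NOT used in this file.  Lane `prim-bschramm`, seat
`prim-bschramm-p2` (gen 38; class C1b; memo `HOME/bschramm/P2-LATTICES.md` §136); helper file (`--supports stmt-CriticalPhenomena-4575 --as helper`).

WHY.  «Slab111HubXFinal» certifies `ShapedLinkage 3 (Slab111.hexShadow k)` for `k ≥ 10` by the zone-free hub gadget; for `k ≤ 9` the gadget fails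
(census kit j314991) although swap pairs exist for every certified triple (`4 ≤ k ≤ 9`, exhaustive search kit j285085/j285847, memo §126).  This
file is a checker the KERNEL can run at small `k`: everything is a natural number.
* §1 The bitboard.  A film vertex near the block centre `z` (class `c₀ = cls z`) with shadow `z + (a, b)`, `triNorm (a,b) ≤ 4`, and level `L ≤ 9` is the
  bit `i = 100·L + 10·(a+5) + (b+5) < 1000`; the three up-steps of `F_k` (shadow `+(1,0), +(0,−1), +(−1,1)`, level `+1`) are the index offsets
  `+110, +99, +91`; vertex sets are masks `m : ℕ`; the neighbourhood of a set is six shifts (`nbh`), reachability is an iterated neighbourhood (`reach`),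
  canonical shortest paths come from BFS layers (`bfsPath`, lowest-index choice via `lowIdx`).
* §2 The case context `Ctx` (thickness `k`, class `c₀`, clip / window parameters, the instance's cleared mask `W`) and its derived masks.
* §3 The certified-terminal filter `needMask` (mirror of `HexShadow.Terminals 3 …` on the bitboard) and the terminal list `esList`.
* §4 Swap-pair PLANS `(c₁, y, b, c₂, avoid)` and the mask `coverOf` of all `w'` they serve; §5 certificate decoding (base `1024`) and the chunk checker
  `checkEs`.  Soundness is in «Slab111SKBits» … «Slab111SKCase».
[cite: DuminilCopinSidoraviciusTassion2016, §2.3 (proof of Fact 2: the three disjoint paths in B_R(z))]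
-/

namespace Summit.CriticalPhenomena.PercolationContinuityZ3.Theorems.Transplant

namespace Slab111.SK

/-! ## §1 The bitboard -/

/-- The level digit of an index. [folklore] -/
def dL (i : ℕ) : ℕ := i / 100
/-- The first column digit `a + 5` of an index. [folklore] -/
def dA (i : ℕ) : ℕ := (i % 100) / 10
/-- The second column digit `b + 5` of an index. [folklore] -/
def dB (i : ℕ) : ℕ := i % 10

/-- The single-bit mask of an index. [folklore] -/
def bitOf (i : ℕ) : ℕ := 2 ^ i

/-- Set difference of masks: `m ∖ x`. [folklore] -/
def sdiff (m x : ℕ) : ℕ := m ^^^ (m &&& x)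

/-- Index adjacency: the two indices differ by one of the three up-step offsets. [folklore] -/
def adjB (i j : ℕ) : Bool := j == i + 110 || j == i + 99 || j == i + 91 || i == j + 110 || i == j + 99 || i == j + 91

/-- **The neighbourhood of a vertex set** inside the universe `u`: six shifts. [folklore] -/
def nbh (u m : ℕ) : ℕ := ((m <<< 110) ||| (m <<< 99) ||| (m <<< 91) ||| (m >>> 110) ||| (m >>> 99) ||| (m >>> 91)) &&& u

/-- One halving step of the lowest-set-bit search. [folklore] -/
def lowStep (st : ℕ × ℕ) (w : ℕ) : ℕ × ℕ := bif st.1 % 2 ^ w == 0 then (st.1 >>> w, st.2 + w) else (st.1 % 2 ^ w, st.2)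

/-- **The index of the lowest set bit** of a mask `< 2^1024` (binary search; `0` has no meaning). [folklore] -/
def lowIdx (m : ℕ) : ℕ := ([512, 256, 128, 64, 32, 16, 8, 4, 2, 1].foldl lowStep (m, 0)).2

/-- Iterated neighbourhood inside `region` (fuel-bounded, stops at the fixpoint). [folklore] -/
def reachGo (u region : ℕ) : ℕ → ℕ → ℕ
  | 0, cur => cur
  | f + 1, cur => let nxt := (cur ||| nbh u cur) &&& region; bif nxt == cur then cur else reachGo u region f nxt

/-- **All vertices reachable from `src ∩ region` by steps inside `region`.** [folklore] -/
def reach (u region src : ℕ) : ℕ := reachGo u region 200 (src &&& region)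

/-- BFS layers from the last layer outward inside `reg`, until the layer containing `s` (fuel-bounded). [folklore] -/
def layersGo (u reg s : ℕ) : ℕ → List ℕ → ℕ → Option (List ℕ)
  | 0, _, _ => none
  | f + 1, layers, vis =>
    match layers with
    | [] => none
    | cur :: _ =>
      let nxt := sdiff (nbh u cur &&& reg) vis
      bif nxt == 0 then none else bif Nat.testBit nxt s then some (nxt :: layers) else layersGo u reg s f (nxt :: layers) (vis ||| nxt)

/-- Walking down the BFS layers from `cur`, always to the lowest-index neighbour in the next layer. [folklore] -/
def walkDown (u : ℕ) : List ℕ → ℕ → List ℕ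
  | [], cur => [cur]
  | L :: rest, cur => cur :: walkDown u rest (lowIdx (nbh u (bitOf cur) &&& L))

/-- **The canonical shortest path from `s` to `t`** with all other vertices in `reg` (none if there is none). [folklore] -/
def bfsPath (u reg s t : ℕ) : Option (List ℕ) :=
  bif s == t then some [s] else
    match layersGo u (reg ||| bitOf s ||| bitOf t) s 60 [bitOf t] (bitOf t) with
    | some (_ :: rest) => some (walkDown u rest s)
    | _ => none

/-- The mask of a list of indices. [folklore] -/
def maskOfList (l : List ℕ) : ℕ := l.foldl (fun m i => m ||| bitOf i) 0

/-- Re-validation of an index path: all vertices in `reg`, consecutive indices adjacent, no repeated index. [folklore] -/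
def pathOK (reg : ℕ) : List ℕ → ℕ → Bool
  | [], _ => true
  | [i], seen => Nat.testBit reg i && !Nat.testBit seen i
  | i :: j :: rest, seen => Nat.testBit reg i && !Nat.testBit seen i && adjB i j && pathOK reg (j :: rest) (seen ||| bitOf i)

/-- The list starts at `s` and ends at `t`. [folklore] -/
def endsOK (l : List ℕ) (s t : ℕ) : Bool := (l.head? == some s) && (l.getLast? == some t)

/-- The mask with bit `i < n` set iff `p i`. [folklore] -/
def maskBelow (p : ℕ → Bool) : ℕ → ℕ
  | 0 => 0
  | i + 1 => bif p i then maskBelow p i ||| bitOf i else maskBelow p i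

/-! ## §2 The case context -/

/-- **A case**: thickness `k ≤ 9`, centre class `c₀`, clip parameters of the rerouting block (`tR, sR`; `3` = unclipped) and window bounds
(`wT, wS`; `9` = unconstrained), and the instance's cleared mask `W`. [folklore] -/
structure Ctx where
  /-- thickness -/
  k : ℕ
  /-- centre class `cls z` -/
  c0 : ℕ
  /-- `t`-clip of the rerouting block: `a ≤ tR` -/
  tR : ℕ
  /-- `s`-clip of the rerouting block: `a + b ≤ sR` -/
  sR : ℕ
  /-- window bound in the `t` direction (`a ≤ wT`) -/
  wT : ℕ
  /-- window bound in the `s` direction (`a + b ≤ wS`) -/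
  wS : ℕ
  /-- the cleared vertex mask -/
  W : ℕ

/-- An index is a film vertex over `hexBall z 4` (digits in range, `triNorm ≤ 4`, level `≤ k`, right class). [folklore] -/
def Ctx.validB (C : Ctx) (i : ℕ) : Bool :=
  decide (i < 1000) && decide (1 ≤ dA i) && decide (dA i ≤ 9) && decide (1 ≤ dB i) && decide (dB i ≤ 9) && decide (6 ≤ dA i + dB i) &&
    decide (dA i + dB i ≤ 14) && decide (dL i ≤ C.k) && (dL i % 3 == (C.c0 + dA i + 2 * dB i) % 3)

/-- The universe mask. [folklore] -/
def Ctx.univ (C : Ctx) : ℕ := maskBelow C.validB 1000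

/-- Column test: over the rerouting block `blkR 3 z tR sR` (`triNorm ≤ 3`, `a ≤ tR`, `a + b ≤ sR`). [folklore] -/
def Ctx.inRB (C : Ctx) (i : ℕ) : Bool :=
  C.validB i && decide (2 ≤ dA i) && decide (dA i ≤ 8) && decide (2 ≤ dB i) && decide (dB i ≤ 8) && decide (7 ≤ dA i + dB i) &&
    decide (dA i + dB i ≤ 13) && decide (dA i ≤ C.tR + 5) && decide (dA i + dB i ≤ C.sR + 10)

/-- Window test (`a ≤ wT`, `a + b ≤ wS`). [folklore] -/
def Ctx.inWinB (C : Ctx) (i : ℕ) : Bool := C.validB i && decide (dA i ≤ C.wT + 5) && decide (dA i + dB i ≤ C.wS + 10)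

/-- Centre-column test. [folklore] -/
def Ctx.cenB (C : Ctx) (i : ℕ) : Bool := C.validB i && (dA i == 5) && (dB i == 5)

/-- The rerouting mask `W ∩ \overline{blkR}`. [folklore] -/
def Ctx.WR (C : Ctx) : ℕ := C.W &&& maskBelow C.inRB 1000
/-- The window mask. [folklore] -/
def Ctx.win (C : Ctx) : ℕ := maskBelow C.inWinB 1000
/-- The centre-column mask. [folklore] -/
def Ctx.cen (C : Ctx) : ℕ := maskBelow C.cenB 1000

/-- The ten level slots of column code `0`. [folklore] -/
def colSlots : ℕ := [0, 1, 2, 3, 4, 5, 6, 7, 8, 9].foldl (fun m L => m ||| bitOf (100 * L)) 0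

/-- The column mask of an index (all universe vertices with the same column digits). [folklore] -/
def Ctx.colM (C : Ctx) (i : ℕ) : ℕ := (colSlots <<< (i % 100)) &&& C.univ

/-- The list of universe neighbours of an index. [folklore] -/
def Ctx.nbrList (C : Ctx) (e : ℕ) : List ℕ :=
  [e + 110, e + 99, e + 91, e - 110, e - 99, e - 91].filter fun j => adjB e j && Nat.testBit C.univ j

/-! ## §3 The certified-terminal filter -/

/-- Outside neighbours: window film vertices adjacent to `e` not in `W`. [folklore] -/
def Ctx.outs (C : Ctx) (e : ℕ) : List ℕ := (C.nbrList e).filter fun j => Nat.testBit C.win j && !Nat.testBit C.W j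
/-- Window neighbours of `e`. [folklore] -/
def Ctx.ins (C : Ctx) (e : ℕ) : List ℕ := (C.nbrList e).filter fun j => Nat.testBit C.win j

/-- OR-accumulation of masks over a list. [folklore] -/
def orFold (l : List ℕ) (g : ℕ → ℕ) : ℕ := l.foldl (fun acc x => acc ||| g x) 0

/-- The witness condition of a quadruple `(o₁, a₁, o₂, a₂)` for the pair `(e₁, e₂)` (the distinctness clauses of `HexShadow.Terminals.nbrs`). [folklore] -/
def Ctx.quadOK (C : Ctx) (e1 e2 o1 a1 o2 a2 : ℕ) : Bool :=
  (a1 != o1) && (a1 != e2) && (o2 != o1) && (o2 != a1) && (a2 != o2) && (a2 != e1) && (a2 != o1) && ((a1 != a2) || Nat.testBit C.cen a1)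

/-- **The need mask of an ordered terminal pair**: all `w'` for which `(E₁, E₂, w')` passes the bitboard mirror of `HexShadow.Terminals`.
[cite: DuminilCopinSidoraviciusTassion2016, §2.3 (proof of Fact 2: u', v', w')] -/
def Ctx.needMask (C : Ctx) (e1 e2 : ℕ) : ℕ :=
  orFold (C.outs e1) fun o1 => orFold (C.ins e1) fun a1 => orFold (C.outs e2) fun o2 => orFold (C.ins e2) fun a2 =>
    bif C.quadOK e1 e2 o1 a1 o2 a2 then
      sdiff C.W (C.cen ||| C.colM e1 ||| C.colM e2 ||| C.colM o1 ||| C.colM a1 ||| C.colM a2 ||| C.colM o2)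
    else 0

/-- **The terminal list**: rerouting vertices off the centre column with an outside neighbour, in increasing order. [folklore] -/
def Ctx.esList (C : Ctx) : List ℕ := (List.range 1000).filter fun i => Nat.testBit C.WR i && !Nat.testBit C.cen i && !(C.outs i).isEmpty

/-! ## §4 Plans and their cover masks -/

/-- **The cover mask of a plan** `(c₁, y, b, c₂, avoid)` for the pair `(e₁, e₂)`: all `w'` reachable from `b` off routing 1 and from `y` off routing 2,
where routing 1 is the canonical path `e₁ ⇝ c₁ → y ⇝ e₂` and routing 2 is `e₁ ⇝ c₂ → b ⇝ e₂`; `0` if the plan is invalid.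
[cite: DuminilCopinSidoraviciusTassion2016, §2.3 (proof of Fact 2)] -/
def Ctx.coverOf (C : Ctx) (e1 e2 c1 y b c2 avoid : ℕ) : ℕ :=
  let u := C.univ
  let W := C.W
  let WR := C.WR
  let static := (e1 != e2) && (y != b) && (y != e1) && (b != e1) && (b != e2) && (c1 != e2) && (c2 != e2) && (y != e2) &&
    ((c1 == e1) || Nat.testBit WR c1) && ((c2 == e1) || Nat.testBit WR c2) && Nat.testBit WR y && Nat.testBit WR b && Nat.testBit W b &&
    adjB c1 y && adjB c1 b && adjB c2 y && adjB c2 b && (c1 != y) && (c1 != b) && (c2 != y) && (c2 != b) &&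
    Nat.testBit u e1 && Nat.testBit u e2 && Nat.testBit WR e1 && Nat.testBit WR e2 &&
    ((avoid &&& (bitOf e1 ||| bitOf e2 ||| bitOf c1 ||| bitOf c2 ||| bitOf y ||| bitOf b)) == 0)
  bif !static then 0 else
  let regA := sdiff WR (bitOf y ||| bitOf b ||| bitOf e2 ||| avoid)
  match bfsPath u regA e1 c1 with
  | none => 0
  | some A =>
    let mA := maskOfList A
    let regY := sdiff WR (mA ||| bitOf b ||| avoid)
    match bfsPath u regY y e2 with
    | none => 0
    | some Y =>
      let sp1 := mA ||| maskOfList Y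
      bif !(pathOK (WR ||| bitOf e1 ||| bitOf c1) A 0 && endsOK A e1 c1 && pathOK (sdiff (WR ||| bitOf e2) mA) Y 0 && endsOK Y y e2) then 0 else
      let good1 := reach u (sdiff W sp1) (bitOf b)
      let oA2 := bif c2 == c1 then some A else bfsPath u regA e1 c2
      match oA2 with
      | none => 0
      | some A2 =>
        let mA2 := maskOfList A2
        let regB := sdiff WR (mA2 ||| bitOf y ||| avoid)
        match bfsPath u regB b e2 with
        | none => 0
        | some B =>
          let sp2 := mA2 ||| maskOfList B
          bif !(pathOK (WR ||| bitOf e1 ||| bitOf c2) A2 0 && endsOK A2 e1 c2 && pathOK (sdiff (WR ||| bitOf e2) mA2) B 0 && endsOK B b e2) then 0 else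
          let good2 := reach u (sdiff W sp2) (bitOf y)
          good1 &&& good2

/-! ## §5 Certificates and the chunk checker -/

/-- Read one base-`1024` digit. [folklore] -/
def rd (n : ℕ) : ℕ × ℕ := (n % 1024, n / 1024)

/-- Read `cnt` digits into a mask of the listed indices. [folklore] -/
def rdMask : ℕ → ℕ → ℕ → ℕ × ℕ
  | 0, n, acc => (acc, n)
  | cnt + 1, n, acc => let p := rd n; rdMask cnt p.2 (acc ||| bitOf p.1)

/-- Read `cnt` plans for the pair `(e₁, e₂)` and accumulate their cover masks. [folklore] -/
def Ctx.rdPlans (C : Ctx) (e1 e2 : ℕ) : ℕ → ℕ → ℕ → ℕ × ℕ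
  | 0, n, acc => (acc, n)
  | cnt + 1, n, acc =>
    let p1 := rd n; let p2 := rd p1.2; let p3 := rd p2.2; let p4 := rd p3.2; let p5 := rd p4.2
    let av := rdMask p5.1 p5.2 0
    let cov := C.coverOf e1 e2 p1.1 p2.1 p3.1 p4.1 av.1
    C.rdPlans e1 e2 cnt av.2 (bif cov == 0 then acc else acc ||| cov)

/-- Check all partners `e₂` of `e₁` against the certificate numeral `n`. [folklore] -/
def Ctx.checkRow (C : Ctx) (e1 : ℕ) : List ℕ → ℕ → Bool
  | [], _ => true
  | e2 :: rest, n =>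
    bif e2 == e1 then C.checkRow e1 rest n else
    let need := C.needMask e1 e2
    bif need == 0 then C.checkRow e1 rest n else
    let p := rd n
    let r := C.rdPlans e1 e2 p.1 p.2 0
    bif sdiff need r.1 == 0 then C.checkRow e1 rest r.2 else false

/-- **The chunk checker**: the rows of the listed terminals `es₁` against one certificate numeral each. [folklore] -/
def Ctx.checkEs (C : Ctx) : List ℕ → List ℕ → Bool
  | [], _ => true
  | e1 :: rest, certs =>
    match certs with
    | [] => false
    | n :: certs' => bif C.checkRow e1 C.esList n then C.checkEs rest certs' else false

/-- The instance's mask is admissible: inside the cleared block `\overline{blkR 3 z tD sD}` restricted as the case prescribes (`W ⊆ allowed`) and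
containing every universe vertex of `hexBall z 1` in it (`forced ⊆ W`). [folklore] -/
def Ctx.wOK (C : Ctx) (allowed forced : ℕ) : Bool := (sdiff C.W allowed == 0) && (sdiff forced C.W == 0)

end Slab111.SK

end Summit.CriticalPhenomena.PercolationContinuityZ3.Theorems.Transplant
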